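import Literature.NumberTheory.Transcendental.KZProductIdeal
import Literature.NumberTheory.Transcendental.KZLogCalculusProofs
import Literature.ModelTheory.ExponentialFields.SemialgebraicSigns
import Literature.NumberTheory.Transcendental.SemialgebraicVolume

/-!
# `NormalFormPrinciple` (stmt-KontsevichZagierPeriods-3869), line `SketchIdeator1` —
# stub `stub_signPresentation`

**Sign presentation of a semialgebraic set.** A `ℚ`-semialgebraic set `A ⊆ ℝᵈ` is
sign-determined by a finite family `F₀` of polynomials over `ℚ`
(`IsSemialgebraic.exists_finset_signDetermined`, Bochnak–Coste–Roy, *Real Algebraic Geometry*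
§2.1): membership in `A` only depends on the sign vector `(sign p(x))_{p ∈ F₀}`. Discarding the
zero polynomial (whose sign is identically `0`) gives a family `F` of nonzero polynomials still
sign-determining `A`. The STRICT sign cells `C_ε = {x | sign p(x) = ε p, p ∈ F}` with
`ε p ∈ {−1, +1}` are pairwise disjoint, and each is either contained in `A` or disjoint from
it; we let `S` be the (finite) set of strict sign vectors whose cell is contained in `A`. A point
of `A` outside `⋃_{ε ∈ S} C_ε` has `p(x) = 0` for some `p ∈ F`, so the defect
`A \ ⋃_{ε ∈ S} C_ε` lies in the finite union of the zero sets of the nonzero polynomials of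
`F`, which is Lebesgue-null (`volume_setOf_aeval_eq_zero`, Caron–Traynor). This is the geometric
input of the reduction engine `stub_volumePiBox` of the line (Kontsevich–Zagier 2001, §1.2:
every period is a difference of volumes of bounded semialgebraic sets, cut into sign cells).
-/

noncomputable section

open MeasureTheory Set
open Literature.NumberTheory.Transcendental Literature.NumberTheory.Transcendental.KZ
open Literature.ModelTheory.ExponentialFields (IsSemialgebraic)

namespace Summit.KontsevichZagierPeriods.HurwitzMicroSectors.NormalFormPrinciple.PiBox

namespace stub_signPresentationAux

open Literature.ModelTheory.ExponentialFields (SignDetermined)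

variable {d : ℕ}

/-- Discarding the zero polynomial keeps a family sign-determining: the sign of the zero
polynomial is `0` at every point. [folklore] -/
theorem signDetermined_filter_ne_zero [DecidableEq (MvPolynomial (Fin d) ℚ)]
    {F₀ : Finset (MvPolynomial (Fin d) ℚ)} {A : Set (Fin d → ℝ)}
    (hF₀ : SignDetermined F₀ A) :
    SignDetermined (F₀.filter (· ≠ 0)) A := by
  intro x y hxy
  refine hF₀ x y fun p hp => ?_
  by_cases hp0 : p = 0
  · subst hp0
    simp only [map_zero]
  · exact hxy p (Finset.mem_filter.2 ⟨hp, hp0⟩)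

/-- A finite union of zero sets of nonzero polynomials over `ℚ` is Lebesgue-null.
[cite: CaronTraynor2005, Theorem (p. 1)] -/
theorem volume_biUnion_setOf_aeval_eq_zero (F : Finset (MvPolynomial (Fin d) ℚ))
    (hF : ∀ p ∈ F, p ≠ 0) :
    volume (⋃ p ∈ F, {x : Fin d → ℝ | MvPolynomial.aeval x p = 0}) = 0 := by
  refine (measure_biUnion_null_iff F.countable_toSet).2 fun p hp => ?_
  refine volume_setOf_aeval_eq_zero p fun h => hF p hp ?_
  refine MvPolynomial.map_injective (algebraMap ℚ ℝ) (algebraMap ℚ ℝ).injective ?_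
  rw [h, map_zero]

/-- If `F` sign-determines `A`, the sign cell of a point `x ∈ A` is contained in `A`.
[folklore] -/
theorem setOf_sign_eq_subset {F : Finset (MvPolynomial (Fin d) ℚ)} {A : Set (Fin d → ℝ)}
    (hF : SignDetermined F A) {x : Fin d → ℝ} (hx : x ∈ A) :
    {y : Fin d → ℝ | ∀ p : F,
      SignType.sign (MvPolynomial.aeval y (p : MvPolynomial (Fin d) ℚ)) =
        SignType.sign (MvPolynomial.aeval x (p : MvPolynomial (Fin d) ℚ))} ⊆ A :=
  fun y hy => (hF y x fun p hp => hy ⟨p, hp⟩).2 hx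

end stub_signPresentationAux

open stub_signPresentationAux in
/-- **Sign presentation of a semialgebraic set**: a `ℚ`-semialgebraic `A ⊆ ℝᵈ` is
sign-determined by a finite family `F` of polynomials
(`IsSemialgebraic.exists_finset_signDetermined`, BCR §2.1), so it is the disjoint union of the
STRICT sign cells `{x | sign p(x) = ε p, p ∈ F}` (`ε p ≠ 0`) it contains, up to the null set
`⋃_{p ∈ F, p ≠ 0} {p = 0}` (`volume_setOf_aeval_eq_zero`).
[cite: BochnakCosteRoy1998, Prop. 2.1.8] -/
theorem stub_signPresentation :
    ∀ (d : ℕ) (A : Set (Fin d → ℝ)), IsSemialgebraic ℚ A →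
    ∃ (F : Finset (MvPolynomial (Fin d) ℚ)) (S : Finset (F → SignType)),
      (∀ ε ∈ S, ∀ p : F, ε p ≠ 0) ∧
      (∀ ε ∈ S, {x | ∀ p : F, SignType.sign (MvPolynomial.aeval x (p : MvPolynomial (Fin d) ℚ)) = ε p} ⊆ A) ∧
      volume (A \ ⋃ ε ∈ S,
        {x | ∀ p : F, SignType.sign (MvPolynomial.aeval x (p : MvPolynomial (Fin d) ℚ)) = ε p}) = 0 := by
  classical
  intro d A hA
  obtain ⟨F₀, hF₀⟩ := hA.exists_finset_signDetermined
  set F : Finset (MvPolynomial (Fin d) ℚ) := F₀.filter (· ≠ 0) with hFdef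
  have hF : Literature.ModelTheory.ExponentialFields.SignDetermined F A :=
    signDetermined_filter_ne_zero hF₀
  have hFne : ∀ p ∈ F, p ≠ 0 := fun p hp => (Finset.mem_filter.1 hp).2
  set S : Finset (F → SignType) := Finset.univ.filter fun ε =>
    (∀ p : F, ε p ≠ 0) ∧
      {x | ∀ p : F,
        SignType.sign (MvPolynomial.aeval x (p : MvPolynomial (Fin d) ℚ)) = ε p} ⊆ A
    with hSdef
  refine ⟨F, S, fun ε hε => (Finset.mem_filter.1 hε).2.1,
    fun ε hε => (Finset.mem_filter.1 hε).2.2, ?_⟩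
  refine measure_mono_null (fun x hx => ?_) (volume_biUnion_setOf_aeval_eq_zero F hFne)
  obtain ⟨hxA, hxU⟩ := hx
  by_contra hxZ
  apply hxU
  -- all the `p ∈ F` are nonvanishing at `x`: its strict sign cell is a `C_ε` with `ε ∈ S`
  have hx0 : ∀ p : F, MvPolynomial.aeval x (p : MvPolynomial (Fin d) ℚ) ≠ 0 := fun p h =>
    hxZ (mem_iUnion₂.2 ⟨(p : MvPolynomial (Fin d) ℚ), p.2, h⟩)
  refine mem_iUnion₂.2
    ⟨fun p : F => SignType.sign (MvPolynomial.aeval x (p : MvPolynomial (Fin d) ℚ)),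
      Finset.mem_filter.2 ⟨Finset.mem_univ _, fun p => ?_, setOf_sign_eq_subset hF hxA⟩,
      fun p => rfl⟩
  rw [Ne, sign_eq_zero_iff]
  exact hx0 p

end Summit.KontsevichZagierPeriods.HurwitzMicroSectors.NormalFormPrinciple.PiBox
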